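import Literature.NumberTheory.LFunctions.ClassGroupLFunctionRootNumber
import Literature.NumberTheory.LFunctions.ClassGroupLFunctionZeroFreeRegion
import Literature.NumberTheory.LFunctions.ExplicitFormulaPsiOne
import Literature.Analysis.SpecialFunctions.DigammaLogBound
import HarnessLib

/-!
# `L'/L(s, χ)` on the line `Re s = −1/2`, uniformly in the field (Thorner–Zaman Lemma 2.6)

Topic `Literature/NumberTheory/LFunctions` (namespace `Literature.NumberTheory.LFunctions.NumberField`).
Everything in this file is PROVED (theorems only).

[ThornerZaman2019, Lemma 2.6] ([LMO, Lemma 6.2]): for a Hecke character `χ` and `Re s = −1/2`,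
`L'/L(s, χ) ≪ log Q + n_K log(|Im s| + 3)`, "from the functional equation and Stirling".  For the
class group characters of a number field `K` of degree `n` (conductor `1`, `Q = |d_K|`) we prove
(`exists_norm_logDeriv_classGroupLFunction_left_le`): there is an ABSOLUTE `A > 0` with

  `‖L'/L(−1/2 + it, χ)‖ ≤ A (n + 1) (log|d_K| + log(|t| + 4))`  for all `K`, `χ`, `t`.

Proof.  Logarithmic differentiation of the closed functional equation
`Λ(1 − s, χ) = χ([𝔡_K]) Λ(s, χ⁻¹)` (`ClassGroupLFunctionRootNumber.lean`) at `s = 3/2 − it`: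
`L'/L(w, χ) = −(γ'/γ)(w) − (γ'/γ)(1 − w) − L'/L(1 − w, χ⁻¹)`, `w = −1/2 + it`, where
`γ(s) = |d_K|^{s/2} Γ_ℝ(s)^{r₁} Γ_ℂ(s)^{r₂}` (`logDeriv_dedekindGammaFactor`:
`γ'/γ = ½ log|d_K| + r₁ Γ_ℝ'/Γ_ℝ + r₂ Γ_ℂ'/Γ_ℂ`), the digamma function is of logarithmic size on
the vertical lines `Re = 1/2, 3/4, 3/2` (the tree's `exists_norm_digamma_vertical_le`, after one
step of `ψ(w + 1) = ψ(w) + 1/w` where needed), and `|L'/L(3/2 − it, χ⁻¹)| ≤ L(Λ_K, 3/2) ≤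
2 + K'(log|d_K| + log 4)` (`re_LSeries_vonMangoldtNorm_ofReal_le`).

## References

* J. Thorner, A. Zaman, *A unified and improved Chebotarev density theorem*, ANT 13 (2019),
  Lemma 2.6. [ThornerZaman2019]
* J. C. Lagarias, H. L. Montgomery, A. M. Odlyzko, Invent. Math. 54 (1979), Lemma 6.2. [folklore]
* J. Neukirch, *Algebraic Number Theory*, VII (8.6). [NeukirchANT1999]
-/

noncomputable section

open scoped NumberField nonZeroDivisors Real
open NumberField NumberField.InfinitePlace Complex Filter Topology Set

namespace Literature.NumberTheory.LFunctions.NumberField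

variable {K : Type*} [Field K] [NumberField K]

/-! ### The gamma factor `Γ_ℂ` and the Dedekind gamma factor: logarithmic derivatives -/

omit [NumberField K] in
/-- `Γ_ℂ` is differentiable off the poles `0, −1, −2, …`. [folklore] -/
theorem differentiableAt_Gammaℂ {s : ℂ} (hs : ∀ m : ℕ, s ≠ -m) : DifferentiableAt ℂ Gammaℂ s := by
  have h2π : (2 * (π : ℂ)) ≠ 0 := mul_ne_zero two_ne_zero (by exact_mod_cast Real.pi_ne_zero)
  have h1 : DifferentiableAt ℂ (fun z : ℂ ↦ (2 * (π : ℂ)) ^ (-z)) s :=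
    DifferentiableAt.const_cpow (differentiableAt_id.neg) (Or.inl h2π)
  have h : Gammaℂ = fun z ↦ 2 * (2 * (π : ℂ)) ^ (-z) * Gamma z := funext Gammaℂ_def
  rw [h]
  exact (h1.const_mul 2).mul (Complex.differentiableAt_Gamma s hs)

omit [NumberField K] in
/-- `Γ_ℂ'/Γ_ℂ(s) = −log 2π + ψ(s)` off the poles. [folklore] -/
theorem logDeriv_Gammaℂ {s : ℂ} (hs : ∀ m : ℕ, s ≠ -m) :
    logDeriv Gammaℂ s = -Complex.log (2 * π) + Complex.digamma s := by
  have h2π : (2 * (π : ℂ)) ≠ 0 := mul_ne_zero two_ne_zero (by exact_mod_cast Real.pi_ne_zero)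
  have hpow : ∀ z : ℂ, (2 * (π : ℂ)) ^ (-z) ≠ 0 := fun z ↦ by
    rw [Ne, Complex.cpow_eq_zero_iff]; exact fun h ↦ h2π h.1
  have hΓ : Gamma s ≠ 0 := Complex.Gamma_ne_zero hs
  have h1 : DifferentiableAt ℂ (fun z : ℂ ↦ (2 * (π : ℂ)) ^ (-z)) s :=
    DifferentiableAt.const_cpow (differentiableAt_id.neg) (Or.inl h2π)
  have h : Gammaℂ = fun z ↦ (2 * (2 * (π : ℂ)) ^ (-z)) * Gamma z := by
    funext z; rw [Gammaℂ_def]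
  rw [h, logDeriv_mul (f := fun z : ℂ ↦ 2 * (2 * (π : ℂ)) ^ (-z)) (g := Gamma) s
      (mul_ne_zero two_ne_zero (hpow s)) hΓ (h1.const_mul 2) (Complex.differentiableAt_Gamma s hs),
    logDeriv_const_mul (f := fun z : ℂ ↦ (2 * (π : ℂ)) ^ (-z)) s 2 two_ne_zero]
  have hd : HasDerivAt (fun z : ℂ ↦ (2 * (π : ℂ)) ^ (-z))
      ((2 * (π : ℂ)) ^ (-s) * Complex.log (2 * π) * (-1)) s := by
    have := (hasDerivAt_neg s).const_cpow (c := 2 * (π : ℂ)) (Or.inl h2π)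
    simpa using this
  rw [logDeriv_apply, hd.deriv, Complex.digamma_def, logDeriv_apply]
  field_simp [hpow s]

/-- The Dedekind gamma factor is differentiable off `0, −1, −2, …`. [folklore] -/
theorem differentiableAt_dedekindGammaFactor {s : ℂ} (hs : ∀ m : ℕ, s ≠ -m) :
    DifferentiableAt ℂ (dedekindGammaFactor K) s := by
  have hs2 : ∀ m : ℕ, s / 2 ≠ -m := fun m h ↦ hs (2 * m) (by
    have := congrArg (fun z : ℂ ↦ 2 * z) h
    simp at this; push_cast; linear_combination this)
  have hd0 : ((discr K).natAbs : ℂ) ≠ 0 := Nat.cast_ne_zero.mpr (Int.natAbs_ne_zero.mpr (discr_ne_zero K))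
  have h1 : DifferentiableAt ℂ (fun z : ℂ ↦ ((discr K).natAbs : ℂ) ^ (z / 2)) s :=
    DifferentiableAt.const_cpow (differentiableAt_id.div_const 2) (Or.inl hd0)
  have h2 : DifferentiableAt ℂ (fun z ↦ Gammaℝ z ^ nrRealPlaces K) s :=
    (RealZeros.hasDerivAt_Gammaℝ hs2).differentiableAt.pow _
  have h3 : DifferentiableAt ℂ (fun z ↦ Gammaℂ z ^ nrComplexPlaces K) s :=
    (differentiableAt_Gammaℂ hs).pow _
  have h : dedekindGammaFactor K = fun z ↦ ((discr K).natAbs : ℂ) ^ (z / 2) * Gammaℝ z ^ nrRealPlaces K *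
      Gammaℂ z ^ nrComplexPlaces K := rfl
  rw [h]
  exact (h1.mul h2).mul h3

/-- **`γ'/γ(s) = ½ log|d_K| + r₁ Γ_ℝ'/Γ_ℝ(s) + r₂ Γ_ℂ'/Γ_ℂ(s)`** off `0, −1, −2, …`, for the gamma
factor `γ(s) = |d_K|^{s/2} Γ_ℝ(s)^{r₁} Γ_ℂ(s)^{r₂}` of `ζ_K`. [folklore] -/
theorem logDeriv_dedekindGammaFactor {s : ℂ} (hs : ∀ m : ℕ, s ≠ -m) :
    logDeriv (dedekindGammaFactor K) s =
      Complex.log ((discr K).natAbs : ℂ) / 2 + nrRealPlaces K * logDeriv Gammaℝ s +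
        nrComplexPlaces K * logDeriv Gammaℂ s := by
  have hs2 : ∀ m : ℕ, s / 2 ≠ -m := fun m h ↦ hs (2 * m) (by
    have := congrArg (fun z : ℂ ↦ 2 * z) h
    simp at this; push_cast; linear_combination this)
  have hd0 : ((discr K).natAbs : ℂ) ≠ 0 := Nat.cast_ne_zero.mpr (Int.natAbs_ne_zero.mpr (discr_ne_zero K))
  have hΓℝ : Gammaℝ s ≠ 0 := by
    rw [Ne, Gammaℝ_eq_zero_iff]
    rintro ⟨m, hm⟩
    exact hs (2 * m) (by rw [hm]; push_cast; ring)
  have hΓℂ : Gammaℂ s ≠ 0 := by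
    rw [Gammaℂ_def]
    refine mul_ne_zero (mul_ne_zero two_ne_zero ?_) (Complex.Gamma_ne_zero hs)
    rw [Ne, Complex.cpow_eq_zero_iff]
    exact fun h ↦ (mul_ne_zero two_ne_zero (by exact_mod_cast Real.pi_ne_zero)) h.1
  have hpow0 : ((discr K).natAbs : ℂ) ^ (s / 2) ≠ 0 := by
    rw [Ne, Complex.cpow_eq_zero_iff]; exact fun h ↦ hd0 h.1
  have h1 : DifferentiableAt ℂ (fun z : ℂ ↦ ((discr K).natAbs : ℂ) ^ (z / 2)) s :=
    DifferentiableAt.const_cpow (differentiableAt_id.div_const 2) (Or.inl hd0)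
  have h2d : DifferentiableAt ℂ Gammaℝ s := (RealZeros.hasDerivAt_Gammaℝ hs2).differentiableAt
  have h3d : DifferentiableAt ℂ Gammaℂ s := differentiableAt_Gammaℂ hs
  have h : dedekindGammaFactor K = fun z ↦ (((discr K).natAbs : ℂ) ^ (z / 2) * Gammaℝ z ^ nrRealPlaces K) *
      Gammaℂ z ^ nrComplexPlaces K := rfl
  rw [h, logDeriv_mul (f := fun z ↦ ((discr K).natAbs : ℂ) ^ (z / 2) * Gammaℝ z ^ nrRealPlaces K)
      (g := fun z ↦ Gammaℂ z ^ nrComplexPlaces K) s (mul_ne_zero hpow0 (pow_ne_zero _ hΓℝ))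
      (pow_ne_zero _ hΓℂ) (h1.mul (h2d.pow _)) (h3d.pow _),
    logDeriv_mul (f := fun z ↦ ((discr K).natAbs : ℂ) ^ (z / 2)) (g := fun z ↦ Gammaℝ z ^ nrRealPlaces K) s
      hpow0 (pow_ne_zero _ hΓℝ) h1 (h2d.pow _)]
  rw [show (fun z ↦ Gammaℝ z ^ nrRealPlaces K) = (Gammaℝ · ^ nrRealPlaces K) from rfl,
    logDeriv_fun_pow h2d, show (fun z ↦ Gammaℂ z ^ nrComplexPlaces K) = (Gammaℂ · ^ nrComplexPlaces K) from rfl,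
    logDeriv_fun_pow h3d]
  have hd : HasDerivAt (fun z : ℂ ↦ ((discr K).natAbs : ℂ) ^ (z / 2))
      (((discr K).natAbs : ℂ) ^ (s / 2) * Complex.log ((discr K).natAbs : ℂ) * (1 / 2)) s := by
    have := ((hasDerivAt_id s).div_const 2).const_cpow (c := ((discr K).natAbs : ℂ)) (Or.inl hd0)
    simpa using this
  rw [logDeriv_apply, hd.deriv]
  field_simp [hpow0]

/-! ### Digamma bounds on the three vertical lines -/

omit [NumberField K] in
/-- `log(1 + |y|) ≤ log(|t| + 4)` when `|y| ≤ |t| + 3`. [folklore] -/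
theorem log_one_add_le_log_add_four {y t : ℝ} (h : |y| ≤ |t| + 3) :
    Real.log (1 + |y|) ≤ Real.log (|t| + 4) :=
  Real.log_le_log (by positivity) (by linarith)

omit [NumberField K] in
/-- **Logarithmic size of `γ'/γ`-ingredients**: there is an absolute `A ≥ 0` such that for all real
`t`: `‖Γ_ℝ'/Γ_ℝ(−1/2 + it)‖, ‖Γ_ℝ'/Γ_ℝ(3/2 + it)‖, ‖Γ_ℂ'/Γ_ℂ(−1/2 + it)‖, ‖Γ_ℂ'/Γ_ℂ(3/2 + it)‖` are all
`≤ A + log(|t| + 4)` (Stirling for `ψ` on vertical lines, `ψ(w+1) = ψ(w) + 1/w`). [folklore] -/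
theorem exists_gammaFactor_logDeriv_bound :
    ∃ A : ℝ, 0 ≤ A ∧ ∀ t : ℝ,
      ‖logDeriv Gammaℝ (-1 / 2 + t * I)‖ ≤ A + Real.log (|t| + 4) ∧
      ‖logDeriv Gammaℝ (3 / 2 + t * I)‖ ≤ A + Real.log (|t| + 4) ∧
      ‖logDeriv Gammaℂ (-1 / 2 + t * I)‖ ≤ A + Real.log (|t| + 4) ∧
      ‖logDeriv Gammaℂ (3 / 2 + t * I)‖ ≤ A + Real.log (|t| + 4) := by
  obtain ⟨C₁, hC₁⟩ := Literature.Analysis.SpecialFunctions.Complex.exists_norm_digamma_vertical_le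
    (a := 3 / 4) (by norm_num)
  obtain ⟨C₂, hC₂⟩ := Literature.Analysis.SpecialFunctions.Complex.exists_norm_digamma_vertical_le
    (a := 1 / 2) (by norm_num)
  obtain ⟨C₃, hC₃⟩ := Literature.Analysis.SpecialFunctions.Complex.exists_norm_digamma_vertical_le
    (a := 3 / 2) (by norm_num)
  have hC₁0 : 0 ≤ C₁ := by
    have := (norm_nonneg _).trans (hC₁ 0); simpa using this
  have hC₂0 : 0 ≤ C₂ := by
    have := (norm_nonneg _).trans (hC₂ 0); simpa using this
  have hC₃0 : 0 ≤ C₃ := by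
    have := (norm_nonneg _).trans (hC₃ 0); simpa using this
  set Lπ : ℝ := ‖Complex.log π‖ with hLπ
  set L2π : ℝ := ‖Complex.log (2 * π)‖ with hL2π
  have hLπ0 : 0 ≤ Lπ := norm_nonneg _
  have hL2π0 : 0 ≤ L2π := norm_nonneg _
  have hn2 : ‖(2 : ℂ)‖ = 2 := by simp
  -- the points are no poles
  have hw_ne : ∀ (t : ℝ) (m : ℕ), (-1 / 2 + t * I : ℂ) ≠ -m := fun t m h ↦ by
    have hre := congrArg Complex.re h
    simp at hre
    have h2 : (2 * m : ℝ) = 1 := by linarith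
    have h3 : (2 * m : ℕ) = 1 := by exact_mod_cast h2
    omega
  have hs_ne : ∀ (t : ℝ) (m : ℕ), (3 / 2 + t * I : ℂ) ≠ -m := fun t m h ↦ by
    have hre := congrArg Complex.re h
    simp at hre
    linarith [m.cast_nonneg (α := ℝ)]
  have hinvw : ∀ t : ℝ, ‖(-1 / 2 + t * I : ℂ)⁻¹‖ ≤ 2 := fun t ↦ by
    rw [norm_inv]
    have h1 : (1 / 2 : ℝ) ≤ ‖(-1 / 2 + t * I : ℂ)‖ := by
      have := Complex.abs_re_le_norm (-1 / 2 + t * I : ℂ)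
      have hre : ((-1 / 2 + t * I : ℂ)).re = -1 / 2 := by simp
      rw [hre] at this
      norm_num at this
      linarith
    calc ‖(-1 / 2 + t * I : ℂ)‖⁻¹ ≤ (1 / 2 : ℝ)⁻¹ := inv_anti₀ (by norm_num) h1
      _ = 2 := by norm_num
  refine ⟨Lπ + L2π + C₁ + C₂ + C₃ + 2, by positivity, fun t ↦ ⟨?_, ?_, ?_, ?_⟩⟩
  · -- `Γ_ℝ'/Γ_ℝ(w)`, `w = -1/2 + it`: shift, `w/2 + 1 = 3/4 + it/2`
    have hw0 : (-1 / 2 + t * I : ℂ) ≠ 0 := by simpa using hw_ne t 0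
    have h := PsiOneExplicit.logDeriv_Gammaℝ_eq_shift (s := -1 / 2 + t * I) (by simp; norm_num) hw0
    set p : ℂ := ((3 / 4 : ℝ) : ℂ) + ((t / 2 : ℝ) : ℂ) * I with hp
    have hpt : (-1 / 2 + t * I : ℂ) / 2 + 1 = p := by rw [hp]; push_cast; ring
    rw [h, hpt, one_div]
    have hψ : ‖Complex.digamma p‖ ≤ C₁ + Real.log (1 + |t / 2|) := hC₁ (t / 2)
    have hy : |t / 2| ≤ |t| + 3 := by rw [abs_div, abs_two]; linarith [abs_nonneg t]
    have hlog := log_one_add_le_log_add_four hy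
    have hlog0 : 0 ≤ Real.log (|t| + 4) := Real.log_nonneg (by linarith [abs_nonneg t])
    have e1 : ‖-Complex.log π / 2‖ = Lπ / 2 := by rw [norm_div, norm_neg, hn2]
    have e2 : ‖Complex.digamma p / 2‖ = ‖Complex.digamma p‖ / 2 := by rw [norm_div, hn2]
    calc ‖-Complex.log π / 2 + Complex.digamma p / 2 - (-1 / 2 + t * I)⁻¹‖
        ≤ ‖-Complex.log π / 2‖ + ‖Complex.digamma p / 2‖ + ‖(-1 / 2 + t * I : ℂ)⁻¹‖ :=
          norm_sub_le_of_le (norm_add_le _ _) le_rfl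
      _ ≤ Lπ / 2 + (C₁ + Real.log (|t| + 4)) / 2 + 2 := by
          rw [e1, e2]; linarith [hinvw t]
      _ ≤ _ := by linarith
  · -- `Γ_ℝ'/Γ_ℝ(3/2 + it)`: `s/2 = 3/4 + it/2`
    have hpole : ∀ m : ℕ, (3 / 2 + t * I : ℂ) / 2 ≠ -m := fun m h ↦ by
      have := congrArg Complex.re h; simp at this; linarith [m.cast_nonneg (α := ℝ)]
    rw [logDeriv_Gammaℝ hpole]
    set p : ℂ := ((3 / 4 : ℝ) : ℂ) + ((t / 2 : ℝ) : ℂ) * I with hp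
    have hpt : (3 / 2 + t * I : ℂ) / 2 = p := by rw [hp]; push_cast; ring
    rw [hpt]
    have hψ : ‖Complex.digamma p‖ ≤ C₁ + Real.log (1 + |t / 2|) := hC₁ (t / 2)
    have hy : |t / 2| ≤ |t| + 3 := by rw [abs_div, abs_two]; linarith [abs_nonneg t]
    have hlog := log_one_add_le_log_add_four hy
    have hlog0 : 0 ≤ Real.log (|t| + 4) := Real.log_nonneg (by linarith [abs_nonneg t])
    have e1 : ‖-Complex.log π / 2‖ = Lπ / 2 := by rw [norm_div, norm_neg, hn2]
    have e2 : ‖Complex.digamma p / 2‖ = ‖Complex.digamma p‖ / 2 := by rw [norm_div, hn2]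
    calc ‖-Complex.log π / 2 + Complex.digamma p / 2‖
        ≤ ‖-Complex.log π / 2‖ + ‖Complex.digamma p / 2‖ := norm_add_le _ _
      _ ≤ Lπ / 2 + (C₁ + Real.log (|t| + 4)) / 2 := by rw [e1, e2]; linarith
      _ ≤ _ := by linarith
  · -- `Γ_ℂ'/Γ_ℂ(w)`: `ψ(w) = ψ(w + 1) − 1/w`, `w + 1 = 1/2 + it`
    rw [logDeriv_Gammaℂ (hw_ne t)]
    have hshift := Complex.digamma_apply_add_one (-1 / 2 + t * I) (hw_ne t)
    set p : ℂ := ((1 / 2 : ℝ) : ℂ) + ((t : ℝ) : ℂ) * I with hp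
    have hpt : (-1 / 2 + t * I : ℂ) + 1 = p := by rw [hp]; push_cast; ring
    rw [hpt] at hshift
    have heq : Complex.digamma (-1 / 2 + t * I) = Complex.digamma p - (-1 / 2 + t * I)⁻¹ := by
      rw [hshift]; ring
    rw [heq]
    have hψ : ‖Complex.digamma p‖ ≤ C₂ + Real.log (1 + |t|) := hC₂ t
    have hlog := log_one_add_le_log_add_four (y := t) (t := t) (by linarith [abs_nonneg t])
    calc ‖-Complex.log (2 * π) + (Complex.digamma p - (-1 / 2 + t * I)⁻¹)‖
        ≤ ‖Complex.log (2 * π)‖ + (‖Complex.digamma p‖ + ‖(-1 / 2 + t * I : ℂ)⁻¹‖) := by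
          refine (norm_add_le _ _).trans (add_le_add (by rw [norm_neg]) (norm_sub_le _ _))
      _ ≤ L2π + ((C₂ + Real.log (|t| + 4)) + 2) := by linarith [hinvw t]
      _ ≤ _ := by linarith
  · -- `Γ_ℂ'/Γ_ℂ(3/2 + it)`
    rw [logDeriv_Gammaℂ (hs_ne t)]
    set p : ℂ := ((3 / 2 : ℝ) : ℂ) + ((t : ℝ) : ℂ) * I with hp
    have hpt : (3 / 2 + t * I : ℂ) = p := by rw [hp]; push_cast; ring
    rw [hpt]
    have hψ : ‖Complex.digamma p‖ ≤ C₃ + Real.log (1 + |t|) := hC₃ t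
    have hlog := log_one_add_le_log_add_four (y := t) (t := t) (by linarith [abs_nonneg t])
    calc ‖-Complex.log (2 * π) + Complex.digamma p‖
        ≤ ‖Complex.log (2 * π)‖ + ‖Complex.digamma p‖ := (norm_add_le _ _).trans (by rw [norm_neg])
      _ ≤ L2π + (C₃ + Real.log (|t| + 4)) := by linarith
      _ ≤ _ := by linarith


/-! ### The gamma factor at `−1/2 + it` and `3/2 − it` -/

/-- **`‖γ'/γ(z)‖ ≤ ½ log|d_K| + n_K (A + log(|t| + 4))`** at `z = −1/2 + it` and `z = 3/2 − it`, with the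
absolute `A` of `exists_gammaFactor_logDeriv_bound` (`r₁ + r₂ ≤ n_K`). [folklore] -/
theorem norm_logDeriv_dedekindGammaFactor_le {A : ℝ} (hA : 0 ≤ A)
    (hbound : ∀ t : ℝ,
      ‖logDeriv Gammaℝ (-1 / 2 + t * I)‖ ≤ A + Real.log (|t| + 4) ∧
      ‖logDeriv Gammaℝ (3 / 2 + t * I)‖ ≤ A + Real.log (|t| + 4) ∧
      ‖logDeriv Gammaℂ (-1 / 2 + t * I)‖ ≤ A + Real.log (|t| + 4) ∧
      ‖logDeriv Gammaℂ (3 / 2 + t * I)‖ ≤ A + Real.log (|t| + 4))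
    (t : ℝ) :
    ‖logDeriv (dedekindGammaFactor K) (-1 / 2 + t * I)‖ ≤
        Real.log ((discr K).natAbs : ℝ) / 2 + Module.finrank ℚ K * (A + Real.log (|t| + 4)) ∧
    ‖logDeriv (dedekindGammaFactor K) (3 / 2 + (-t) * I)‖ ≤
        Real.log ((discr K).natAbs : ℝ) / 2 + Module.finrank ℚ K * (A + Real.log (|t| + 4)) := by
  have hd1 : (1 : ℝ) ≤ ((discr K).natAbs : ℝ) := by
    have h := Int.one_le_abs (NumberField.discr_ne_zero K)
    rw [Int.abs_eq_natAbs] at h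
    exact_mod_cast h
  have hlogd : ‖Complex.log ((discr K).natAbs : ℂ) / 2‖ = Real.log ((discr K).natAbs : ℝ) / 2 := by
    rw [norm_div, ← Complex.natCast_log, Complex.norm_real, Real.norm_of_nonneg (Real.log_nonneg hd1)]
    simp
  have hn : (nrRealPlaces K : ℝ) + nrComplexPlaces K ≤ Module.finrank ℚ K := by
    have h := card_add_two_mul_card_eq_rank K
    have : (nrRealPlaces K : ℝ) + 2 * nrComplexPlaces K = Module.finrank ℚ K := by exact_mod_cast h
    linarith [(nrComplexPlaces K).cast_nonneg (α := ℝ)]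
  have hlog0 : 0 ≤ Real.log (|t| + 4) := Real.log_nonneg (by linarith [abs_nonneg t])
  have key : ∀ z : ℂ, (∀ m : ℕ, z ≠ -m) →
      ‖logDeriv Gammaℝ z‖ ≤ A + Real.log (|t| + 4) → ‖logDeriv Gammaℂ z‖ ≤ A + Real.log (|t| + 4) →
      ‖logDeriv (dedekindGammaFactor K) z‖ ≤
        Real.log ((discr K).natAbs : ℝ) / 2 + Module.finrank ℚ K * (A + Real.log (|t| + 4)) := by
    intro z hz hℝ hℂ
    rw [logDeriv_dedekindGammaFactor hz]
    calc ‖Complex.log ((discr K).natAbs : ℂ) / 2 + nrRealPlaces K * logDeriv Gammaℝ z +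
          nrComplexPlaces K * logDeriv Gammaℂ z‖
        ≤ ‖Complex.log ((discr K).natAbs : ℂ) / 2‖ + ‖(nrRealPlaces K : ℂ) * logDeriv Gammaℝ z‖ +
            ‖(nrComplexPlaces K : ℂ) * logDeriv Gammaℂ z‖ := norm_add₃_le
      _ = Real.log ((discr K).natAbs : ℝ) / 2 + nrRealPlaces K * ‖logDeriv Gammaℝ z‖ +
            nrComplexPlaces K * ‖logDeriv Gammaℂ z‖ := by
          rw [hlogd, norm_mul, norm_mul, Complex.norm_natCast, Complex.norm_natCast]
      _ ≤ Real.log ((discr K).natAbs : ℝ) / 2 + nrRealPlaces K * (A + Real.log (|t| + 4)) +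
            nrComplexPlaces K * (A + Real.log (|t| + 4)) := by gcongr
      _ ≤ _ := by nlinarith
  have hw_ne : ∀ m : ℕ, (-1 / 2 + t * I : ℂ) ≠ -m := fun m h ↦ by
    have hre := congrArg Complex.re h
    simp at hre
    have h2 : (2 * m : ℝ) = 1 := by linarith
    have h3 : (2 * m : ℕ) = 1 := by exact_mod_cast h2
    omega
  have hs_ne : ∀ m : ℕ, (3 / 2 + (-t) * I : ℂ) ≠ -m := fun m h ↦ by
    have hre := congrArg Complex.re h
    simp at hre
    linarith [m.cast_nonneg (α := ℝ)]
  obtain ⟨h1, -, h3, -⟩ := hbound t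
  obtain ⟨-, h2, -, h4⟩ := hbound (-t)
  rw [abs_neg] at h2 h4
  have hpt : ((-t : ℝ) : ℂ) = -(t : ℂ) := by push_cast; ring
  rw [hpt] at h2 h4
  exact ⟨key _ hw_ne h1 h3, key _ hs_ne h2 h4⟩

/-! ### `L'/L` at `3/2 − it` -/

/-- `‖L'/L(s, χ)‖ ≤ 2 + 77760(5n_K + 2)(log|d_K| + log 4)` for `Re s = 3/2`: `|L(Λ_χ, s)| ≤ L(Λ_K, 3/2)`
and the Stark-type bound. [folklore] -/
theorem norm_logDeriv_classGroupLFunction_three_halves_le (χ : ClassGroup (𝓞 K) →* ℂˣ) (t : ℝ) :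
    ‖logDeriv (classGroupLFunction K χ) (3 / 2 + t * I)‖ ≤
      2 + 77760 * (5 * Module.finrank ℚ K + 2) * (Real.log ((discr K).natAbs : ℝ) + Real.log 4) := by
  have hs : 1 < (3 / 2 + t * I : ℂ).re := by simp; norm_num
  rw [logDeriv_apply, ← norm_neg, neg_logDeriv_classGroupLFunction_eq K χ hs]
  have h1 := TwistedZFR.norm_LSeries_le_of_norm_le
    (norm_twistVonMangoldt_le (norm_classGroupCharIdealHom_le χ))
    (fun s hs ↦ LSeriesSummable_vonMangoldtNorm hs) (s := 3 / 2 + t * I) (σ' := 3 / 2)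
    (by norm_num) (by simp)
  have h2 := re_LSeries_vonMangoldtNorm_ofReal_le (K := K) (σ := 3 / 2) (by norm_num) (by norm_num)
  have hpt : ((3 / 2 : ℝ) : ℂ) = 3 / 2 := by push_cast; ring
  rw [hpt] at h1 h2
  have h3 : (1 : ℝ) / (3 / 2 - 1) = 2 := by norm_num
  rw [h3] at h2
  linarith

/-! ### The functional equation, logarithmically differentiated -/

/-- **`L'/L(w, χ) = −γ'/γ(w) − γ'/γ(1 − w) − L'/L(1 − w, χ⁻¹)`** at `w = −1/2 + it`
(`1 − w = 3/2 − it`), from `Λ(1 − s, χ) = χ([𝔡_K]) Λ(s, χ⁻¹)` near `s = 3/2 − it`, where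
`Λ(s, χ⁻¹) ≠ 0`. [cite: ThornerZaman2019, Lemma 2.6] -/
theorem logDeriv_classGroupLFunction_left (χ : ClassGroup (𝓞 K) →* ℂˣ) (t : ℝ) :
    logDeriv (classGroupLFunction K χ) (-1 / 2 + t * I) =
      -logDeriv (dedekindGammaFactor K) (-1 / 2 + t * I) -
        logDeriv (dedekindGammaFactor K) (3 / 2 + (-t) * I) -
          logDeriv (classGroupLFunction K χ⁻¹) (3 / 2 + (-t) * I) := by
  set w : ℂ := -1 / 2 + t * I with hw
  set s₀ : ℂ := 3 / 2 + (-t) * I with hs₀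
  have hws : w = 1 - s₀ := by rw [hw, hs₀]; ring
  have hs₀re : s₀.re = 3 / 2 := by simp [hs₀]
  have hwre : w.re = -1 / 2 := by simp [hw]
  have hs₀1 : 1 < s₀.re := by rw [hs₀re]; norm_num
  have hs₀Z : ∀ n : ℤ, s₀ ≠ n := fun n h ↦ by
    have := congrArg Complex.re h
    rw [hs₀re] at this; simp at this
    have h2 : (2 * n : ℝ) = 3 := by linarith
    have h3 : (2 * n : ℤ) = 3 := by exact_mod_cast h2
    omega
  have hwZ : ∀ n : ℤ, w ≠ n := fun n h ↦ by
    have := congrArg Complex.re h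
    rw [hwre] at this; simp at this
    have h2 : (2 * n : ℝ) = -1 := by linarith
    have h3 : (2 * n : ℤ) = -1 := by exact_mod_cast h2
    omega
  have hwN : ∀ m : ℕ, w ≠ -m := fun m h ↦ hwZ (-m) (by rw [h]; push_cast; ring)
  have hs₀N : ∀ m : ℕ, s₀ ≠ -m := fun m h ↦ hs₀Z (-m) (by rw [h]; push_cast; ring)
  have hw1 : w ≠ 1 := fun h ↦ hwZ 1 (by rw [h]; push_cast; ring)
  have hs₀1' : s₀ ≠ 1 := fun h ↦ hs₀Z 1 (by rw [h]; push_cast; ring)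
  set W : ℂ := (χ (differentClass K) : ℂ) with hW
  have hW0 : W ≠ 0 := fun h ↦ by
    have := norm_rootNumber (K := K) χ
    rw [← hW, h, norm_zero] at this; exact zero_ne_one this
  set γ := dedekindGammaFactor K with hγdef
  set Lχ := classGroupLFunction K χ with hLχ
  set Lχ' := classGroupLFunction K χ⁻¹ with hLχ'
  -- differentiability and non-vanishing at the two points
  have hγw : DifferentiableAt ℂ γ w := differentiableAt_dedekindGammaFactor hwN
  have hγs : DifferentiableAt ℂ γ s₀ := differentiableAt_dedekindGammaFactor hs₀N
  have hLw : DifferentiableAt ℂ Lχ w := differentiableAt_classGroupLFunction χ hw1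
  have hLs : DifferentiableAt ℂ Lχ' s₀ := differentiableAt_classGroupLFunction χ⁻¹ hs₀1'
  have hγs0 : γ s₀ ≠ 0 := dedekindGammaFactor_ne_zero hs₀Z
  have hγw0 : γ w ≠ 0 := dedekindGammaFactor_ne_zero hwZ
  have hLs0 : Lχ' s₀ ≠ 0 := classGroupLFunction_ne_zero_of_one_lt_re K χ⁻¹ hs₀1
  -- the functional equation near `s₀`
  set F : ℂ → ℂ := fun s ↦ γ (1 - s) * Lχ (1 - s) with hF
  set G : ℂ → ℂ := fun s ↦ W * (γ s * Lχ' s) with hG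
  have hFG : F =ᶠ[𝓝 s₀] G := by
    have hball : Metric.ball s₀ (1 / 2) ∈ 𝓝 s₀ := Metric.ball_mem_nhds _ (by norm_num)
    filter_upwards [hball] with s hs
    have hsZ : ∀ n : ℤ, s ≠ n := by
      intro n h
      rw [Metric.mem_ball, dist_eq_norm] at hs
      have hre := Complex.abs_re_le_norm (s - s₀)
      rw [Complex.sub_re, hs₀re] at hre
      have hlt' : |s.re - 3 / 2| < 1 / 2 := lt_of_le_of_lt hre hs
      have hsre : s.re = n := by rw [h]; simp
      rw [hsre] at hlt'
      have hlt : |(n : ℝ) - 3 / 2| < 1 / 2 := hlt'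
      rw [abs_lt] at hlt
      have h1 : (1 : ℝ) < n := by linarith
      have h2 : (n : ℝ) < 2 := by linarith
      have h1' : (1 : ℤ) < n := by exact_mod_cast h1
      have h2' : n < (2 : ℤ) := by exact_mod_cast h2
      omega
    simp only [hF, hG, hγdef, hLχ, hLχ', hW]
    exact completedClassGroupLFunction_one_sub χ hsZ
  -- values and derivatives at `s₀`
  have hFs : F s₀ = γ w * Lχ w := by simp only [hF, hws]
  have hGs : G s₀ = W * (γ s₀ * Lχ' s₀) := rfl
  have hFG0 : F s₀ = G s₀ := hFG.eq_of_nhds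
  have hΛw0 : γ w * Lχ w ≠ 0 := by
    rw [← hFs, hFG0, hGs]; exact mul_ne_zero hW0 (mul_ne_zero hγs0 hLs0)
  have hLw0 : Lχ w ≠ 0 := fun h ↦ hΛw0 (by rw [h, mul_zero])
  have hΛ : DifferentiableAt ℂ (fun z ↦ γ z * Lχ z) w := hγw.mul hLw
  have hdF : deriv F s₀ = -deriv (fun z ↦ γ z * Lχ z) w := by
    have hcomp : F = (fun z ↦ γ z * Lχ z) ∘ (fun s ↦ 1 - s) := rfl
    have h1 : HasDerivAt (fun s : ℂ ↦ 1 - s) (-1) s₀ := by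
      simpa using (hasDerivAt_id s₀).const_sub 1
    have hΛ' : DifferentiableAt ℂ (fun z ↦ γ z * Lχ z) (1 - s₀) := by rw [← hws]; exact hΛ
    rw [hcomp, deriv_comp s₀ hΛ' h1.differentiableAt, h1.deriv, ← hws]
    ring
  have hdG : deriv G s₀ = W * deriv (fun z ↦ γ z * Lχ' z) s₀ := by
    simp only [hG]
    exact deriv_const_mul W (hγs.mul hLs)
  have hdFG : deriv F s₀ = deriv G s₀ := hFG.deriv_eq
  -- logarithmic derivatives
  have hlogΛ : logDeriv (fun z ↦ γ z * Lχ z) w = -logDeriv (fun z ↦ γ z * Lχ' z) s₀ := by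
    rw [logDeriv_apply, logDeriv_apply]
    have e1 : deriv (fun z ↦ γ z * Lχ z) w = -deriv F s₀ := by rw [hdF]; ring
    rw [e1, ← hFs, hFG0, hdFG, hdG, hGs]
    field_simp
  rw [logDeriv_mul w hγw0 hLw0 hγw hLw] at hlogΛ
  rw [logDeriv_mul s₀ hγs0 hLs0 hγs hLs] at hlogΛ
  linear_combination hlogΛ

/-! ### The bound -/

/-- **Thorner–Zaman Lemma 2.6 for class group characters, uniformly in the field**: there is an
ABSOLUTE `A > 0` such that for every number field `K`, every class group character `χ` of `K` and
every real `t`, `‖L'/L(−1/2 + it, χ)‖ ≤ A (n_K + 1) (log|d_K| + log(|t| + 4))`.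
[cite: ThornerZaman2019, Lemma 2.6] -/
theorem exists_norm_logDeriv_classGroupLFunction_left_le :
    ∃ A : ℝ, 0 < A ∧ ∀ (K : Type) [Field K] [NumberField K] (χ : ClassGroup (𝓞 K) →* ℂˣ) (t : ℝ),
      ‖logDeriv (classGroupLFunction K χ) (-1 / 2 + t * I)‖ ≤
        A * (Module.finrank ℚ K + 1) * (Real.log ((discr K).natAbs : ℝ) + Real.log (|t| + 4)) := by
  obtain ⟨A, hA, hb⟩ := exists_gammaFactor_logDeriv_bound
  refine ⟨2 * A + 544325, by positivity, fun K _ _ χ t ↦ ?_⟩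
  have hd1 : (1 : ℝ) ≤ ((discr K).natAbs : ℝ) := by
    have h := Int.one_le_abs (NumberField.discr_ne_zero K)
    rw [Int.abs_eq_natAbs] at h
    exact_mod_cast h
  set n : ℕ := Module.finrank ℚ K with hn
  set ℒ : ℝ := Real.log ((discr K).natAbs : ℝ) + Real.log (|t| + 4) with hℒ
  have hlogd : 0 ≤ Real.log ((discr K).natAbs : ℝ) := Real.log_nonneg hd1
  have hℓ1 : 1 ≤ Real.log (|t| + 4) := ClassicalZFRData.one_le_log_tau t
  have hℒ1 : 1 ≤ ℒ := by linarith
  have hℒ₀ℒ : Real.log ((discr K).natAbs : ℝ) + Real.log 4 ≤ ℒ :=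
    UniformTwistedZFRData.log_add_log_four_le _ t
  have hℒ₀0 : 0 ≤ Real.log ((discr K).natAbs : ℝ) + Real.log 4 := by
    have := UniformTwistedZFRData.log_add_log_four_ge hd1; linarith
  obtain ⟨hγ1, hγ2⟩ := norm_logDeriv_dedekindGammaFactor_le (K := K) hA hb t
  have hL := norm_logDeriv_classGroupLFunction_three_halves_le (K := K) χ⁻¹ (-t)
  have hpt : ((-t : ℝ) : ℂ) = -(t : ℂ) := by push_cast; ring
  rw [hpt] at hL
  rw [logDeriv_classGroupLFunction_left χ t]
  have hn0 : (0 : ℝ) ≤ n := n.cast_nonneg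
  calc ‖-logDeriv (dedekindGammaFactor K) (-1 / 2 + t * I) - logDeriv (dedekindGammaFactor K) (3 / 2 + -(t : ℂ) * I) -
        logDeriv (classGroupLFunction K χ⁻¹) (3 / 2 + -(t : ℂ) * I)‖
      ≤ ‖logDeriv (dedekindGammaFactor K) (-1 / 2 + t * I)‖ + ‖logDeriv (dedekindGammaFactor K) (3 / 2 + -(t : ℂ) * I)‖ +
          ‖logDeriv (classGroupLFunction K χ⁻¹) (3 / 2 + -(t : ℂ) * I)‖ := by
        refine (norm_sub_le _ _).trans (add_le_add ((norm_sub_le _ _).trans (by rw [norm_neg])) le_rfl)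
    _ ≤ 2 * (Real.log ((discr K).natAbs : ℝ) / 2 + n * (A + Real.log (|t| + 4))) +
          (2 + 77760 * (5 * n + 2) * (Real.log ((discr K).natAbs : ℝ) + Real.log 4)) := by
        have hpt' : (3 / 2 + -(t : ℂ) * I : ℂ) = 3 / 2 + ((-t : ℝ) : ℂ) * I := by push_cast; ring
        linarith
    _ ≤ (2 * A + 544325) * (n + 1) * ℒ := by
        have h1 : Real.log ((discr K).natAbs : ℝ) ≤ ℒ := by linarith
        have h2 : Real.log (|t| + 4) ≤ ℒ := by linarith
        have h3 : (2 : ℝ) ≤ 2 * ℒ := by linarith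
        have h4 : 77760 * (5 * n + 2) * (Real.log ((discr K).natAbs : ℝ) + Real.log 4) ≤
            77760 * (5 * n + 2) * ℒ := mul_le_mul_of_nonneg_left hℒ₀ℒ (by positivity)
        nlinarith [mul_nonneg hn0 hA, mul_nonneg hn0 (by linarith : (0 : ℝ) ≤ ℒ),
          mul_nonneg hA (by linarith : (0 : ℝ) ≤ ℒ)]

end Literature.NumberTheory.LFunctions.NumberField

end
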